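import Mathlib
import HarnessLib.Audit
import Summits.PneNP.PneNP.Theorems.AeaCutRectanglesDutyRectangles
import Summits.PneNP.PneNP.Theorems.AeaCutRectanglesCaroWei

/-!
# Pair-compatibility bookends for X1 `FoolingMeasure` — proved (crux workfile `SwapBookends`, seat p4 g2)

FRONTIER restricted-model rung (AEA cut rectangles vs NON-3-COL, crux `AeaCutRectangles.FoolingMeasure`, cell `pnp-ideate`);
nothing here bears on `P` versus `NP`.

The planner seat p4 (lens «barrier») typed in `Cruxes/FoolingMeasure/SwapBookends.lean` two elementary inequalities bracketing
X1's rectangle clause at a cut `B` by the DENSITY of joint capturability, leaving both as `sorry` (sizes S and M).  This file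
proves them, with the definitions restated verbatim (`NonCol`, `JointlyCapturable`, `ValidRect`, `pSwap`, `incompat`), so the
workfile can import and `exact` them:

* `rect_sum_sq_le_pSwap` (UPPER bookend, swap test): for `μ ≥ 0` and a valid rectangle `𝓐 ⊗ 𝓑` at `B`,
  `(Σ_{(α,β) ∈ 𝓐 ×ˢ 𝓑} μ (α ∪ β))² ≤ pSwap μ B` — the union map is injective on `𝓐 ×ˢ 𝓑`
  (`AeaCutRectanglesTransversalEngine.parts_unique`) and any two members `α ∪ β`, `α' ∪ β'` of the rectangle are jointly capturable
  (their cross hybrids `α ∪ β'`, `α' ∪ β` lie in the rectangle); hence `rect_sum_le_of_pSwap_le_sq`.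
* `exists_validRect_ge_caroWei` (LOWER bookend, weighted Caro–Wei `AeaCutRectanglesCaroWei.exists_independent_ge`): for `μ ≥ 0`
  supported on loopless non-3-colourable edge sets, some valid rectangle at `B` has mass `≥ Σ_S μ S / (c_B(S) + 1)`, `c_B(S)` the
  number of support members not jointly capturable with `S` — a pairwise jointly capturable sub-family `𝒦` of the support spans the
  valid rectangle `{S_A : S ∈ 𝒦} ⊗ {S_B : S ∈ 𝒦}`, which contains every `S ∈ 𝒦`.
-/

set_option linter.dupNamespace false

namespace Summit.PneNP.PneNP.Theorems.AeaCutRectanglesSwapBookends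

open Finset
open Summit.PneNP.PneNP.Theorems.AeaCutRectanglesTransversalEngine (parts_unique)
open Summit.PneNP.PneNP.Theorems.AeaCutRectanglesDutyRectangles (aliceSide bobSide mem_aliceSide mem_bobSide aliceSide_union_bobSide)
open Summit.PneNP.PneNP.Theorems.AeaCutRectanglesCaroWei (degIn potential exists_independent_ge)

variable {V : Type*} [Fintype V] [DecidableEq V]

/-! ## Definitions (verbatim from the crux workfile) -/

/-- Non-3-colourability of the graph spanned by a finite edge set (X1's phrasing). -/
def NonCol (S : Finset (Sym2 V)) : Prop :=
  ¬ (SimpleGraph.fromEdgeSet ((S : Finset (Sym2 V)) : Set (Sym2 V))).Colorable 3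

/-- `S, S'` are jointly capturable at the cut `B`: both cross hybrids are non-3-colourable. -/
def JointlyCapturable (B : Finset V) (S S' : Finset (Sym2 V)) : Prop :=
  NonCol (aliceSide B S ∪ bobSide B S') ∧ NonCol (aliceSide B S' ∪ bobSide B S)

/-- The three hypotheses of X1's rectangle clause at the cut `B` (verbatim shape of `FoolingMeasure`). -/
def ValidRect (B : Finset V) (𝓐 𝓑 : Finset (Finset (Sym2 V))) : Prop :=
  (∀ α ∈ 𝓐, ∀ e ∈ α, ¬ e.IsDiag ∧ ∃ v ∈ e, v ∉ B) ∧
  (∀ β ∈ 𝓑, ∀ e ∈ β, ¬ e.IsDiag ∧ ∀ v ∈ e, v ∈ B) ∧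
  (∀ α ∈ 𝓐, ∀ β ∈ 𝓑, NonCol (α ∪ β))

open Classical in
/-- Swap mass `p_swap(B) = ∑_{S,S'} μ S · μ S' · [S, S' jointly capturable at B]`. -/
noncomputable def pSwap (μ : Finset (Sym2 V) → ℝ) (B : Finset V) : ℝ :=
  ∑ S : Finset (Sym2 V), ∑ S' : Finset (Sym2 V), if JointlyCapturable B S S' then μ S * μ S' else 0

open Classical in
/-- Incompatibility count `c_B(S)`: support members NOT jointly capturable with `S` at `B`. -/
noncomputable def incompat (μ : Finset (Sym2 V) → ℝ) (B : Finset V) (S : Finset (Sym2 V)) : ℕ :=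
  (univ.filter fun S' : Finset (Sym2 V) => μ S' ≠ 0 ∧ ¬ JointlyCapturable B S S').card

/-! ## Sides of a rectangle member -/

/-- Alice's side of `α ∪ β` is `α` (when `α`'s edges meet `V ∖ B` and `β`'s edges are inside `B`). -/
theorem aliceSide_union_eq {B : Finset V} {α β : Finset (Sym2 V)} (hα : ∀ e ∈ α, ∃ v ∈ e, v ∉ B)
    (hβ : ∀ e ∈ β, ∀ v ∈ e, v ∈ B) : aliceSide B (α ∪ β) = α := by
  ext e
  rw [mem_aliceSide, mem_union]
  constructor
  · rintro ⟨h | h, v, hv, hvB⟩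
    · exact h
    · exact absurd (hβ e h v hv) hvB
  · exact fun h => ⟨Or.inl h, hα e h⟩

/-- Bob's side of `α ∪ β` is `β` (same hypotheses). -/
theorem bobSide_union_eq {B : Finset V} {α β : Finset (Sym2 V)} (hα : ∀ e ∈ α, ∃ v ∈ e, v ∉ B)
    (hβ : ∀ e ∈ β, ∀ v ∈ e, v ∈ B) : bobSide B (α ∪ β) = β := by
  ext e
  rw [mem_bobSide, mem_union]
  constructor
  · rintro ⟨h | h, hall⟩
    · obtain ⟨v, hv, hvB⟩ := hα e h
      exact absurd (hall v hv) hvB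
    · exact h
  · exact fun h => ⟨Or.inr h, hβ e h⟩

/-- Two members of a valid rectangle are jointly capturable. -/
theorem jointlyCapturable_of_validRect {B : Finset V} {𝓐 𝓑 : Finset (Finset (Sym2 V))} (hR : ValidRect B 𝓐 𝓑)
    {α α' β β' : Finset (Sym2 V)} (hα : α ∈ 𝓐) (hα' : α' ∈ 𝓐) (hβ : β ∈ 𝓑) (hβ' : β' ∈ 𝓑) :
    JointlyCapturable B (α ∪ β) (α' ∪ β') := by
  obtain ⟨h𝓐, h𝓑, hN⟩ := hR
  have eα : ∀ e ∈ α, ∃ v ∈ e, v ∉ B := fun e he => (h𝓐 α hα e he).2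
  have eα' : ∀ e ∈ α', ∃ v ∈ e, v ∉ B := fun e he => (h𝓐 α' hα' e he).2
  have eβ : ∀ e ∈ β, ∀ v ∈ e, v ∈ B := fun e he => (h𝓑 β hβ e he).2
  have eβ' : ∀ e ∈ β', ∀ v ∈ e, v ∈ B := fun e he => (h𝓑 β' hβ' e he).2
  unfold JointlyCapturable
  rw [aliceSide_union_eq eα eβ, bobSide_union_eq eα' eβ', aliceSide_union_eq eα' eβ', bobSide_union_eq eα eβ]
  exact ⟨hN α hα β' hβ', hN α' hα' β hβ⟩

/-! ## The upper bookend -/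

/-- **UPPER BOOKEND (swap test).**  For `μ ≥ 0` and a valid rectangle `𝓐 ⊗ 𝓑` at `B`, the rectangle mass squared is at most the
swap mass. -/
theorem rect_sum_sq_le_pSwap (μ : Finset (Sym2 V) → ℝ) (hμ : ∀ S, 0 ≤ μ S) (B : Finset V)
    (𝓐 𝓑 : Finset (Finset (Sym2 V))) (hR : ValidRect B 𝓐 𝓑) :
    (∑ q ∈ 𝓐 ×ˢ 𝓑, μ (q.1 ∪ q.2)) ^ 2 ≤ pSwap μ B := by
  classical
  -- the union map is injective on the rectangle
  have hinj : ∀ q ∈ 𝓐 ×ˢ 𝓑, ∀ q' ∈ 𝓐 ×ˢ 𝓑, q.1 ∪ q.2 = q'.1 ∪ q'.2 → q = q' := by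
    intro q hq q' hq' h
    obtain ⟨hq1, hq2⟩ := mem_product.1 hq
    obtain ⟨hq1', hq2'⟩ := mem_product.1 hq'
    obtain ⟨h1, h2⟩ := parts_unique h (fun e he => (hR.1 _ hq1 e he).2) (fun e he => (hR.1 _ hq1' e he).2)
      (fun e he => (hR.2.1 _ hq2 e he).2) (fun e he => (hR.2.1 _ hq2' e he).2)
    exact Prod.ext h1 h2
  set T := (𝓐 ×ˢ 𝓑).image fun q => q.1 ∪ q.2 with hT
  have hsum : ∑ q ∈ 𝓐 ×ˢ 𝓑, μ (q.1 ∪ q.2) = ∑ S ∈ T, μ S := by rw [hT, sum_image hinj]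
  -- members of the rectangle are pairwise jointly capturable
  have hJC : ∀ S ∈ T, ∀ S' ∈ T, JointlyCapturable B S S' := by
    intro S hS S' hS'
    obtain ⟨q, hq, rfl⟩ := mem_image.1 hS
    obtain ⟨q', hq', rfl⟩ := mem_image.1 hS'
    obtain ⟨hq1, hq2⟩ := mem_product.1 hq
    obtain ⟨hq1', hq2'⟩ := mem_product.1 hq'
    exact jointlyCapturable_of_validRect hR hq1 hq1' hq2 hq2'
  rw [hsum, sq, sum_mul_sum]
  unfold pSwap
  calc ∑ S ∈ T, ∑ S' ∈ T, μ S * μ S'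
      = ∑ S ∈ T, ∑ S' ∈ T, (if JointlyCapturable B S S' then μ S * μ S' else 0) :=
        sum_congr rfl fun S hS => sum_congr rfl fun S' hS' => by rw [if_pos (hJC S hS S' hS')]
    _ ≤ ∑ S ∈ T, ∑ S' : Finset (Sym2 V), (if JointlyCapturable B S S' then μ S * μ S' else 0) :=
        sum_le_sum fun S _ => sum_le_sum_of_subset_of_nonneg (subset_univ _) fun S' _ _ => by
          split_ifs
          · exact mul_nonneg (hμ S) (hμ S')
          · exact le_rfl
    _ ≤ ∑ S : Finset (Sym2 V), ∑ S' : Finset (Sym2 V), (if JointlyCapturable B S S' then μ S * μ S' else 0) :=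
        sum_le_sum_of_subset_of_nonneg (subset_univ _) fun S _ _ => sum_nonneg fun S' _ => by
          split_ifs
          · exact mul_nonneg (hμ S) (hμ S')
          · exact le_rfl

/-- Consequence: `pSwap μ B ≤ δ²` makes X1's rectangle clause hold at `B` with bound `δ`. -/
theorem rect_sum_le_of_pSwap_le_sq (μ : Finset (Sym2 V) → ℝ) (hμ : ∀ S, 0 ≤ μ S) (B : Finset V) {δ : ℝ}
    (hδ : 0 ≤ δ) (hswap : pSwap μ B ≤ δ ^ 2)
    (𝓐 𝓑 : Finset (Finset (Sym2 V))) (hR : ValidRect B 𝓐 𝓑) :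
    ∑ q ∈ 𝓐 ×ˢ 𝓑, μ (q.1 ∪ q.2) ≤ δ := by
  have h1 := rect_sum_sq_le_pSwap μ hμ B 𝓐 𝓑 hR
  have h0 : 0 ≤ ∑ q ∈ 𝓐 ×ˢ 𝓑, μ (q.1 ∪ q.2) := sum_nonneg fun q _ => hμ _
  nlinarith [h1, h0, hδ, hswap]

/-! ## The lower bookend -/

/-- Joint capturability is symmetric. -/
theorem jointlyCapturable_comm (B : Finset V) (S S' : Finset (Sym2 V)) : JointlyCapturable B S S' ↔ JointlyCapturable B S' S := by
  unfold JointlyCapturable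
  exact And.comm

/-- A non-3-colourable set is jointly capturable with itself. -/
theorem jointlyCapturable_self (B : Finset V) {S : Finset (Sym2 V)} (hS : NonCol S) : JointlyCapturable B S S := by
  unfold JointlyCapturable
  rw [aliceSide_union_bobSide]
  exact ⟨hS, hS⟩

/-- **LOWER BOOKEND (weighted Caro–Wei).**  For `μ ≥ 0` supported on loopless non-3-colourable edge sets, some valid rectangle at
`B` has mass at least `∑_S μ S / (c_B(S) + 1)`. -/
theorem exists_validRect_ge_caroWei (μ : Finset (Sym2 V) → ℝ) (hμ : ∀ S, 0 ≤ μ S)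
    (hsupp : ∀ S, μ S ≠ 0 → (∀ e ∈ S, ¬ e.IsDiag) ∧ NonCol S) (B : Finset V) :
    ∃ 𝓐 𝓑 : Finset (Finset (Sym2 V)), ValidRect B 𝓐 𝓑 ∧
      ∑ S : Finset (Sym2 V), μ S / ((incompat μ B S : ℝ) + 1) ≤ ∑ q ∈ 𝓐 ×ˢ 𝓑, μ (q.1 ∪ q.2) := by
  classical
  -- the incompatibility graph on the support
  set supp : Finset (Finset (Sym2 V)) := univ.filter fun S => μ S ≠ 0 with hsuppdef
  set adj : Finset (Sym2 V) → Finset (Sym2 V) → Prop := fun S S' => ¬ JointlyCapturable B S S' with hadj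
  have hsymm : ∀ S S', adj S S' → adj S' S := fun S S' h h' => h ((jointlyCapturable_comm B S' S).1 h')
  obtain ⟨𝒦, h𝒦supp, hind, hpot⟩ := exists_independent_ge adj hsymm μ hμ supp
  have h𝒦 : ∀ S ∈ 𝒦, μ S ≠ 0 := fun S hS => (mem_filter.1 (h𝒦supp hS)).2
  have hJC : ∀ S ∈ 𝒦, ∀ S' ∈ 𝒦, JointlyCapturable B S S' := by
    intro S hS S' hS'
    by_cases h : S = S'
    · subst h; exact jointlyCapturable_self B (hsupp S (h𝒦 S hS)).2
    · have := hind S hS S' hS' h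
      simp only [hadj, not_not] at this
      exact this
  -- the rectangle spanned by `𝒦`
  refine ⟨𝒦.image (aliceSide B), 𝒦.image (bobSide B), ⟨?_, ?_, ?_⟩, ?_⟩
  · intro α hα e he
    obtain ⟨S, hS, rfl⟩ := mem_image.1 hα
    obtain ⟨heS, hout⟩ := mem_aliceSide.1 he
    exact ⟨(hsupp S (h𝒦 S hS)).1 e heS, hout⟩
  · intro β hβ e he
    obtain ⟨S, hS, rfl⟩ := mem_image.1 hβ
    obtain ⟨heS, hin⟩ := mem_bobSide.1 he
    exact ⟨(hsupp S (h𝒦 S hS)).1 e heS, hin⟩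
  · intro α hα β hβ
    obtain ⟨S, hS, rfl⟩ := mem_image.1 hα
    obtain ⟨S', hS', rfl⟩ := mem_image.1 hβ
    exact (hJC S hS S' hS').1
  · -- mass: the potential is the Caro–Wei potential of the support, and `𝒦` sits inside the rectangle
    have hpot_eq : ∑ S : Finset (Sym2 V), μ S / ((incompat μ B S : ℝ) + 1) = potential adj supp μ := by
      unfold potential
      rw [← sum_filter_add_sum_filter_not univ (fun S => μ S ≠ 0)]
      have hzero : ∑ S ∈ univ.filter (fun S => ¬ μ S ≠ 0), μ S / ((incompat μ B S : ℝ) + 1) = 0 :=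
        sum_eq_zero fun S hS => by
          have : μ S = 0 := by simpa using (mem_filter.1 hS).2
          rw [this, zero_div]
      rw [hzero, add_zero]
      refine sum_congr rfl fun S hS => ?_
      have hS0 : μ S ≠ 0 := (mem_filter.1 hS).2
      have hdeg : incompat μ B S = degIn adj supp S := by
        unfold incompat AeaCutRectanglesCaroWei.degIn
        congr 1
        ext S'
        simp only [mem_filter, mem_univ, true_and, hsuppdef, hadj]
        constructor
        · rintro ⟨h0, hn⟩
          refine ⟨h0, fun h => ?_, hn⟩
          subst h
          exact hn (jointlyCapturable_self B (hsupp _ hS0).2)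
        · rintro ⟨h0, -, hn⟩
          exact ⟨h0, hn⟩
      rw [hdeg]
    have hmass : ∑ S ∈ 𝒦, μ S ≤ ∑ q ∈ 𝒦.image (aliceSide B) ×ˢ 𝒦.image (bobSide B), μ (q.1 ∪ q.2) := by
      set s : Finset (Sym2 V) → Finset (Sym2 V) × Finset (Sym2 V) := fun S => (aliceSide B S, bobSide B S) with hs
      have hinj : ∀ S ∈ 𝒦, ∀ S' ∈ 𝒦, s S = s S' → S = S' := by
        intro S _ S' _ h
        have h1 : aliceSide B S = aliceSide B S' := congrArg Prod.fst h
        have h2 : bobSide B S = bobSide B S' := congrArg Prod.snd h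
        rw [← aliceSide_union_bobSide B S, ← aliceSide_union_bobSide B S', h1, h2]
      have hval : ∀ S ∈ 𝒦, μ S = μ ((s S).1 ∪ (s S).2) := fun S _ => by
        simp only [hs, aliceSide_union_bobSide]
      rw [sum_congr rfl hval, ← sum_image (f := fun q => μ (q.1 ∪ q.2)) hinj]
      refine sum_le_sum_of_subset_of_nonneg (fun q hq => ?_) fun q _ _ => hμ _
      obtain ⟨S, hS, rfl⟩ := mem_image.1 hq
      exact mem_product.2 ⟨mem_image_of_mem _ hS, mem_image_of_mem _ hS⟩
    rw [hpot_eq]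
    exact hpot.trans hmass

end Summit.PneNP.PneNP.Theorems.AeaCutRectanglesSwapBookends
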